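import Literature.NumberTheory.EllipticCurves.CMFormalActionLaneTransport
import Literature.NumberTheory.EllipticCurves.FormalGroupLubinTateDivisionPointsTateUnitUnique
import HarnessLib

/-!
# TATE-UNIT-CM: the Tate units of two families of division points related by the CM action of a `v`-unit `δ` differ by `e(δ)`
# (OQ-A1 of the j = 0 seam: level-independence of the period constant `A_M = θ(a_M)·ι⁻¹(w₀ μ_M)`; de Shalit II §4.3–4.4 — proofs only)

Topic `NumberTheory/EllipticCurves` (theorems only; no definition, no named fact, no instance).  Cell `bsd-print-cf2`, width seat
`bsd-line-cf2c-w4` g16, the CM half of TATE-UNIT (LEAD R-OQ-A1); the Lubin–Tate half is cf2-p1-w2's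
`FormalGroupLubinTateDivisionPointsTateUnitUnique` (U1)–(U3).  Setting: the lane of the (α)-assembly (`e : 𝒪_F ≃ ℤ_p`, `π`, `P`,
integer model `W`, the lane curve `W ⊗ 𝒪_F` over the levels `M_n = E·K_π^{n+1}`), two families of kernel points READ from complex
arguments, `U_n = ι_vξ(u_n)` and `U′_n = ι_vξ(u′_n)`, with `α·u′_n ≡ u_n (mod Λ)` for the complex reading `α = ι̂(j α_R)` of a CM
multiplier, Tate units `a` (serving `U`) and `a′` (serving `U′`) in the sense of B10a / `SeamBridgeOfReadings`
(`P(h_{P′,f}([a]_f ω_{n+1})) = U_n`), and the multiplier's CM datum over the data ring `R` — the formal action `T_R` reading the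
Lubin–Tate endomorphism `[c]_{P′}` of a UNIT `c ∈ 𝒪_Fˣ` (`hTP`), the transformation pair with its `R`-lifts, the series identities
`hidX`/`hidY` at the base points `ξ(Ω₁)`, `ξ(αΩ₁)`, and the auxiliary readings `ξ(Ω₁ + u′_n)`, `ξ(α(Ω₁ + u′_n))` at each level.

* `map_hom_eq_hom_LTCoeff` — `[c]_{[π]} ⊗_{e⁻¹} 𝒪_F = [e⁻¹c]_{P′}` (`LubinTate.map_hom`), linking `hom_eq_of_map_eq_of_map_eq` to `hTP`;
* ★★★ `tateUnit_eq_mul_of_cm_readings` — **`a = c·a′`**: levelwise `[c]_{P′} z(U′_n) = z(U_n)`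
  (`CMFormalActionLaneTransport.ltSMul_zPt_eq_zPt_of_readings_of_hom`, non-vanishing from `c ∈ 𝒪_Fˣ`), then (U3)
  `unit_eq_mul_of_zPt_eq_ltSMul`.

APPLICATION (the seam, OQ-A1): two levels `M ⊂ M′` of the elliptic-unit moduli, `𝔪_{M′} ≤ 𝔪_M = (μ_M)`, base points
`Ω_M = ι(δ)·Ω_{M′}`, `δ = μ_{M′}/μ_M` a `v`-unit; `CMFormalActionLaneTransport.divisionPt_sub_mul_divisionPt_mem` gives
`u_{n+1}(M) ≡ ι(δ)·u_{n+1}(M′)`, `SeamBridgeOfLane` gives `(a_M, u(M))` and `(a_{M′}, u(M′))` with their point properties, and this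
theorem gives `a_M = e(δ)·a_{M′}`, i.e. `a_M·e(μ_M) = a_{M′}·e(μ_{M′})` — the period constant is level-independent.
No summit statement is proved; BSD is not proved by any of this.

## References
* [deShalit1987] E. de Shalit, *Iwasawa theory of elliptic curves with complex multiplication* (1987), II §1.10, II §4.3 (p. 57: «`Ω_p`
  is uniquely determined modulo `𝒪_𝔭ˣ`»), II §4.4 (iii)–(iv), II §4.9 Proposition (ii).
* [LubinTate1965] J. Lubin, J. Tate, *Formal complex multiplication in local fields* (1965), §1 Thm. 1.
* [CasselsFrohlichANT1967] J. W. S. Cassels, A. Fröhlich (eds.), *Algebraic Number Theory* (1967), Ch. VI §3.5 Prop. 2.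
* [SilvermanAEC2009] J. H. Silverman, *The Arithmetic of Elliptic Curves*, 2nd ed. (2009), III.2.3, VII.2.2.
-/

noncomputable section

open scoped Classical PeriodPair
open Polynomial

namespace Literature.NumberTheory.EllipticCurves

open ValuativeRel Literature.NumberTheory.GaloisRepresentations
  Literature.NumberTheory.GaloisRepresentations.IsNonarchimedeanLocalField
  Literature.NumberTheory.GaloisRepresentations.LubinTate Field
open Literature.NumberTheory.EllipticCurves.FormalGroupChart _root_.WeierstrassCurve _root_.PeriodPair

section HomTransport

variable {F : Type} [Field F] [ValuativeRel F] [TopologicalSpace F] [IsNonarchimedeanLocalField F]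

variable {p : ℕ} [Fact p.Prime] (e : 𝒪[F] ≃+* ℤ_[p]) (hq : residueFieldCard F = p)
  {π : 𝒪[F]} (hπ : (valuation F).IsUniformizer (π : F)) {πZ : ℤ_[p]} (he : e π = πZ)
  (hA : IsLTRing πZ p) {P : PowerSeries ℤ_[p]} (hP : IsLTSeries πZ p P)

include he hq in
/-- **`[c]_{[π]} ⊗ 𝒪_F = [e⁻¹c]_{P′}`**: the Lubin–Tate endomorphism series of the lane's `ℤ_p`-datum, read over `LTCoeff F` along
`e⁻¹ : ℤ_p ≅ 𝒪_F`, is the endomorphism series of the transported datum `(isLTRing_LTCoeff hπ, P ⊗ 𝒪_F)` at `e⁻¹ c`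
(`LubinTate.map_hom`) — the link between `CMFormalActionLaneTransport.hom_eq_of_map_eq_of_map_eq` (`[c]_{[π]} = [c]_ℤ` over `ℤ_p`)
and the hypothesis `hTP` of `tateUnit_eq_mul_of_cm_readings`. [cite: CasselsFrohlichANT1967, Ch. VI §3.5 Prop. 2] [cite: deShalit1987, II §1.10] -/
theorem map_hom_eq_hom_LTCoeff (c : ℤ_[p]) :
    (hom hA hP hP c).map ((LTCoeff.of F).toRingHom.comp e.symm.toRingHom) =
      hom (isLTRing_LTCoeff hπ) (isLTSeries_map_LTCoeff_of_degree_one e hq he hP)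
        (isLTSeries_map_LTCoeff_of_degree_one e hq he hP) (LTCoeff.of F (e.symm c)) := by
  rw [map_hom ((LTCoeff.of F).toRingHom.comp e.symm.toRingHom) hA hP hP (isLTRing_LTCoeff hπ)
    (isLTSeries_map_LTCoeff_of_degree_one e hq he hP) (isLTSeries_map_LTCoeff_of_degree_one e hq he hP) c]
  rfl

end HomTransport

section TateUnitCM

variable {F : Type} [Field F] [ValuativeRel F] [TopologicalSpace F] [IsNonarchimedeanLocalField F]

attribute [local instance] ltNormUniformSpace ltNormIsUniformAddGroup rk1 nF nE fintypeResidueField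

variable {p : ℕ} [Fact p.Prime] (e : 𝒪[F] ≃+* ℤ_[p]) (hq : residueFieldCard F = p)
  {π : 𝒪[F]} (hπ : (valuation F).IsUniformizer (π : F)) {πZ : ℤ_[p]} (he : e π = πZ)
  {P : PowerSeries ℤ_[p]} (hP : IsLTSeries πZ p P) (W : WeierstrassCurve ℤ)
  (E : IntermediateField F (AlgebraicClosure F)) [FiniteDimensional F E]
  [hEll : ∀ n : ℕ, (curveOver (E ⊔ ltField π n : IntermediateField F (AlgebraicClosure F))
    ((W.map (Int.castRingHom ℤ_[p])).map ((LTCoeff.of F).toRingHom.comp e.symm.toRingHom))).IsElliptic]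
  {Kb : Type*} [Field Kb] (ιc : Kb →+* ℂ) (ιv : Kb →+* AlgebraicClosure F)
  {R : Type*} [CommRing R] (ψ : R →+* unitBall E) (j : R →+* Kb)
  (hψj : ∀ r : R, ((((ψ r : unitBall E) : E) : AlgebraicClosure F)) = ιv (j r))
  (L : PeriodPair) (h₂ : L.g₂ = (W.baseChange ℂ).c₄ / 12) (h₃ : L.g₃ = (W.baseChange ℂ).c₆ / 216)

include hq he hψj h₂ h₃ in
/-- ★★★ **TATE-UNIT-CM: `a = c·a′`** — see the module docstring.  Data per level `n`: readings of `U_n = ι_vξ(u_n)`, `U′_n = ι_vξ(u′_n)`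
(`α u′_n ≡ u_n (mod Λ)`), of `ξ(Ω₁ + u′_n)` and `ξ(α(Ω₁ + u′_n))`; the point properties of `a` (for `U`) and `a′` (for `U′`);
the CM datum of the multiplier over `R` with `T_R ⊗_ψ 𝒪 = [c]_{P′} ⊗ 𝒪`, `c ∈ 𝒪_Fˣ`.
[cite: deShalit1987, II §4.3 (p. 57), II §4.4 (iv), II §4.9 Proposition (ii)] [cite: LubinTate1965, §1 Thm. 1]
[cite: SilvermanAEC2009, III.2.3, VII.2.2] -/
theorem tateUnit_eq_mul_of_cm_readings
    -- the CM datum of the multiplier `α` over `R`: complex transformation pair, `R`-lifts, the formal action reading `[c]_{P′}`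
    {αR : R} {PC QC : ℂ[X]}
    (hT : ∀ z : ℂ, z ∉ L.lattice → ιc (j αR) * z ∉ L.lattice → PC.eval (℘[L] z) = ℘[L] (ιc (j αR) * z) * QC.eval (℘[L] z))
    (hQC : ∀ z : ℂ, z ∉ L.lattice → ιc (j αR) * z ∉ L.lattice → QC.eval (℘[L] z) ≠ 0)
    {Pr Qr : R[X]} {s : ℂ} (hs : s ≠ 0)
    (hQr : Qr.map (ιc.comp j) = C s * QC.comp (X + C ((W.baseChange ℂ).b₂ / 12)))
    (hPr : Pr.map (ιc.comp j) = C s * (PC.comp (X + C ((W.baseChange ℂ).b₂ / 12)) -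
      C ((W.baseChange ℂ).b₂ / 12) * QC.comp (X + C ((W.baseChange ℂ).b₂ / 12))))
    (c : 𝒪[F]ˣ) {T : PowerSeries R} (hT0 : PowerSeries.constantCoeff T = 0)
    (hTP : T.map ψ = (hom (isLTRing_LTCoeff hπ) (isLTSeries_map_LTCoeff_of_degree_one e hq he hP)
      (isLTSeries_map_LTCoeff_of_degree_one e hq he hP) (LTCoeff.of F (c : 𝒪[F]))).map (algebraMap (LTCoeff F) (unitBall E)))
    {x₀ y₀ x₁ y₁ : R}
    (hidX : (((W.map (Int.castRingHom R)).translateX x₁ y₁).subst T + PowerSeries.C (0 : R)) *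
        Polynomial.aeval ((W.map (Int.castRingHom R)).translateX x₀ y₀ + PowerSeries.C (0 : R)) Qr =
      Polynomial.aeval ((W.map (Int.castRingHom R)).translateX x₀ y₀ + PowerSeries.C (0 : R)) Pr)
    (hidY : PowerSeries.C αR * (2 * PowerSeries.subst T ((W.map (Int.castRingHom R)).translateY x₁ y₁) +
            PowerSeries.C (W.map (Int.castRingHom R)).a₁ * PowerSeries.subst T ((W.map (Int.castRingHom R)).translateX x₁ y₁) +
            PowerSeries.C (W.map (Int.castRingHom R)).a₃) *
          Polynomial.aeval ((W.map (Int.castRingHom R)).translateX x₀ y₀ + PowerSeries.C (0 : R)) Qr +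
        (PowerSeries.subst T ((W.map (Int.castRingHom R)).translateX x₁ y₁) + PowerSeries.C (0 : R)) *
          Polynomial.aeval ((W.map (Int.castRingHom R)).translateX x₀ y₀ + PowerSeries.C (0 : R)) (Polynomial.derivative Qr) *
          (2 * (W.map (Int.castRingHom R)).translateY x₀ y₀ +
            PowerSeries.C (W.map (Int.castRingHom R)).a₁ * (W.map (Int.castRingHom R)).translateX x₀ y₀ +
            PowerSeries.C (W.map (Int.castRingHom R)).a₃) =
      Polynomial.aeval ((W.map (Int.castRingHom R)).translateX x₀ y₀ + PowerSeries.C (0 : R)) (Polynomial.derivative Pr) *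
        (2 * (W.map (Int.castRingHom R)).translateY x₀ y₀ +
          PowerSeries.C (W.map (Int.castRingHom R)).a₁ * (W.map (Int.castRingHom R)).translateX x₀ y₀ +
          PowerSeries.C (W.map (Int.castRingHom R)).a₃))
    -- the base points `ξ(Ω₁)`, `ξ(αΩ₁)` over `R`
    {Ω₁ : ℂ} (hΩ₁ : Ω₁ ∉ L.lattice) (hαΩ₁ : ιc (j αR) * Ω₁ ∉ L.lattice)
    (hx₀ : ιc (j x₀) = ℘[L] Ω₁ - (W.baseChange ℂ).b₂ / 12)
    (hy₀ : ιc (j y₀) = (℘'[L] Ω₁ - (W.baseChange ℂ).a₁ * (℘[L] Ω₁ - (W.baseChange ℂ).b₂ / 12) - (W.baseChange ℂ).a₃) / 2)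
    (hx₁ : ιc (j x₁) = ℘[L] (ιc (j αR) * Ω₁) - (W.baseChange ℂ).b₂ / 12)
    (hy₁ : ιc (j y₁) = (℘'[L] (ιc (j αR) * Ω₁) - (W.baseChange ℂ).a₁ * (℘[L] (ιc (j αR) * Ω₁) - (W.baseChange ℂ).b₂ / 12) -
      (W.baseChange ℂ).a₃) / 2)
    -- the complex arguments of the two families, `α u′_n ≡ u_n (mod Λ)`
    (u u' : ℕ → ℂ) (hu : ∀ n, u n ∉ L.lattice) (hu' : ∀ n, u' n ∉ L.lattice) (hw : ∀ n, Ω₁ + u' n ∉ L.lattice)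
    (hαw : ∀ n, ιc (j αR) * (Ω₁ + u' n) ∉ L.lattice) (hαu : ∀ n, ιc (j αR) * u' n - u n ∈ L.lattice)
    -- their readings, levelwise, and those of `ξ(Ω₁ + u′_n)`, `ξ(α(Ω₁ + u′_n))`
    (xu yu xu' yu' xw yw xz yz : ℕ → Kb)
    (hxu : ∀ n, ιc (xu n) = ℘[L] (u n) - (W.baseChange ℂ).b₂ / 12)
    (hyu : ∀ n, ιc (yu n) = (℘'[L] (u n) - (W.baseChange ℂ).a₁ * (℘[L] (u n) - (W.baseChange ℂ).b₂ / 12) - (W.baseChange ℂ).a₃) / 2)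
    (hxu' : ∀ n, ιc (xu' n) = ℘[L] (u' n) - (W.baseChange ℂ).b₂ / 12)
    (hyu' : ∀ n, ιc (yu' n) = (℘'[L] (u' n) - (W.baseChange ℂ).a₁ * (℘[L] (u' n) - (W.baseChange ℂ).b₂ / 12) - (W.baseChange ℂ).a₃) / 2)
    (hxw : ∀ n, ιc (xw n) = ℘[L] (Ω₁ + u' n) - (W.baseChange ℂ).b₂ / 12)
    (hyw : ∀ n, ιc (yw n) = (℘'[L] (Ω₁ + u' n) - (W.baseChange ℂ).a₁ * (℘[L] (Ω₁ + u' n) - (W.baseChange ℂ).b₂ / 12) -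
      (W.baseChange ℂ).a₃) / 2)
    (hxz : ∀ n, ιc (xz n) = ℘[L] (ιc (j αR) * (Ω₁ + u' n)) - (W.baseChange ℂ).b₂ / 12)
    (hyz : ∀ n, ιc (yz n) = (℘'[L] (ιc (j αR) * (Ω₁ + u' n)) - (W.baseChange ℂ).a₁ * (℘[L] (ιc (j αR) * (Ω₁ + u' n)) -
      (W.baseChange ℂ).b₂ / 12) - (W.baseChange ℂ).a₃) / 2)
    (XU YU XU' YU' XW YW XZ YZ : ∀ n : ℕ, ↥(E ⊔ ltField π n : IntermediateField F (AlgebraicClosure F)))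
    (hXU : ∀ n, ((XU n : ↥(E ⊔ ltField π n : IntermediateField F (AlgebraicClosure F))) : AlgebraicClosure F) = ιv (xu n))
    (hYU : ∀ n, ((YU n : ↥(E ⊔ ltField π n : IntermediateField F (AlgebraicClosure F))) : AlgebraicClosure F) = ιv (yu n))
    (hXU' : ∀ n, ((XU' n : ↥(E ⊔ ltField π n : IntermediateField F (AlgebraicClosure F))) : AlgebraicClosure F) = ιv (xu' n))
    (hYU' : ∀ n, ((YU' n : ↥(E ⊔ ltField π n : IntermediateField F (AlgebraicClosure F))) : AlgebraicClosure F) = ιv (yu' n))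
    (hXW : ∀ n, ((XW n : ↥(E ⊔ ltField π n : IntermediateField F (AlgebraicClosure F))) : AlgebraicClosure F) = ιv (xw n))
    (hYW : ∀ n, ((YW n : ↥(E ⊔ ltField π n : IntermediateField F (AlgebraicClosure F))) : AlgebraicClosure F) = ιv (yw n))
    (hXZ : ∀ n, ((XZ n : ↥(E ⊔ ltField π n : IntermediateField F (AlgebraicClosure F))) : AlgebraicClosure F) = ιv (xz n))
    (hYZ : ∀ n, ((YZ n : ↥(E ⊔ ltField π n : IntermediateField F (AlgebraicClosure F))) : AlgebraicClosure F) = ιv (yz n))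
    -- the two Tate units with their point properties
    {a a' : 𝒪[F]ˣ}
    (ha : ∀ (n : ℕ) (h : (curveOver (E ⊔ ltField π n : IntermediateField F (AlgebraicClosure F))
        ((W.map (Int.castRingHom ℤ_[p])).map ((LTCoeff.of F).toRingHom.comp e.symm.toRingHom))).toAffine.Nonsingular (XU n) (YU n)),
      ptOfZ (E ⊔ ltField π n : IntermediateField F (AlgebraicClosure F))
          ((W.map (Int.castRingHom ℤ_[p])).map ((LTCoeff.of F).toRingHom.comp e.symm.toRingHom))
          (evalPt₁ (maxNilIdeal F (E ⊔ ltField π n : IntermediateField F (AlgebraicClosure F)))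
            (hom (isLTRing_LTCoeff hπ) (isLTSeries_map_LTCoeff_of_degree_one e hq he hP) (isLTSeries_LTCoeff π) 1)
            (constantCoeff_hom _ _ _ 1)
            (evalPt₁ (maxNilIdeal F (E ⊔ ltField π n : IntermediateField F (AlgebraicClosure F)))
              (hom (isLTRing_LTCoeff hπ) (isLTSeries_LTCoeff π) (isLTSeries_LTCoeff π) (LTCoeff.of F (a : 𝒪[F])))
              (constantCoeff_hom _ _ _ _)
              (inclPt (le_sup_right : ltField π n ≤ E ⊔ ltField π n) (cohPt hπ n)))) =
        (.some (XU n) (YU n) h : (curveOver (E ⊔ ltField π n : IntermediateField F (AlgebraicClosure F))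
          ((W.map (Int.castRingHom ℤ_[p])).map ((LTCoeff.of F).toRingHom.comp e.symm.toRingHom))).toAffine.Point))
    (ha' : ∀ (n : ℕ) (h : (curveOver (E ⊔ ltField π n : IntermediateField F (AlgebraicClosure F))
        ((W.map (Int.castRingHom ℤ_[p])).map ((LTCoeff.of F).toRingHom.comp e.symm.toRingHom))).toAffine.Nonsingular (XU' n) (YU' n)),
      ptOfZ (E ⊔ ltField π n : IntermediateField F (AlgebraicClosure F))
          ((W.map (Int.castRingHom ℤ_[p])).map ((LTCoeff.of F).toRingHom.comp e.symm.toRingHom))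
          (evalPt₁ (maxNilIdeal F (E ⊔ ltField π n : IntermediateField F (AlgebraicClosure F)))
            (hom (isLTRing_LTCoeff hπ) (isLTSeries_map_LTCoeff_of_degree_one e hq he hP) (isLTSeries_LTCoeff π) 1)
            (constantCoeff_hom _ _ _ 1)
            (evalPt₁ (maxNilIdeal F (E ⊔ ltField π n : IntermediateField F (AlgebraicClosure F)))
              (hom (isLTRing_LTCoeff hπ) (isLTSeries_LTCoeff π) (isLTSeries_LTCoeff π) (LTCoeff.of F (a' : 𝒪[F])))
              (constantCoeff_hom _ _ _ _)
              (inclPt (le_sup_right : ltField π n ≤ E ⊔ ltField π n) (cohPt hπ n)))) =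
        (.some (XU' n) (YU' n) h : (curveOver (E ⊔ ltField π n : IntermediateField F (AlgebraicClosure F))
          ((W.map (Int.castRingHom ℤ_[p])).map ((LTCoeff.of F).toRingHom.comp e.symm.toRingHom))).toAffine.Point)) :
    a = c * a' := by
  -- characteristic zero of the levels: `2 ≠ 0`
  haveI : CharZero 𝒪[F] := e.toRingHom.charZero
  haveI : CharZero F := charZero_of_injective_algebraMap (R := 𝒪[F]) (A := F) Subtype.val_injective
  haveI : CharZero (AlgebraicClosure F) := charZero_of_injective_algebraMap (algebraMap F (AlgebraicClosure F)).injective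
  have htwo : ∀ (M : IntermediateField F (AlgebraicClosure F)), (2 : M) ≠ 0 := fun M h => by
    have h1 := congrArg (algebraMap M (AlgebraicClosure F)) h
    rw [map_ofNat, map_zero] at h1
    exact two_ne_zero h1
  -- nonsingularity and kernel membership of the two families (the latter from the point properties: `P(t) ∈ E₁`)
  have hnU : ∀ n : ℕ, (curveOver (E ⊔ ltField π n : IntermediateField F (AlgebraicClosure F))
      ((W.map (Int.castRingHom ℤ_[p])).map ((LTCoeff.of F).toRingHom.comp e.symm.toRingHom))).toAffine.Nonsingular (XU n) (YU n) :=
    fun n => nonsingular_curveOver_of_readings e _ W ιc ιv L h₂ h₃ (hu n) (hxu n) (hyu n) (hXU n) (hYU n)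
  have hnU' : ∀ n : ℕ, (curveOver (E ⊔ ltField π n : IntermediateField F (AlgebraicClosure F))
      ((W.map (Int.castRingHom ℤ_[p])).map ((LTCoeff.of F).toRingHom.comp e.symm.toRingHom))).toAffine.Nonsingular (XU' n) (YU' n) :=
    fun n => nonsingular_curveOver_of_readings e _ W ιc ιv L h₂ h₃ (hu' n) (hxu' n) (hyu' n) (hXU' n) (hYU' n)
  have hU : ∀ n : ℕ, (.some (XU n) (YU n) (hnU n) : (curveOver (E ⊔ ltField π n : IntermediateField F (AlgebraicClosure F))
      ((W.map (Int.castRingHom ℤ_[p])).map ((LTCoeff.of F).toRingHom.comp e.symm.toRingHom))).toAffine.Point) ∈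
      kernel (NormedField.valuation (K := (E ⊔ ltField π n : IntermediateField F (AlgebraicClosure F))))
        (curveOver (E ⊔ ltField π n : IntermediateField F (AlgebraicClosure F))
          ((W.map (Int.castRingHom ℤ_[p])).map ((LTCoeff.of F).toRingHom.comp e.symm.toRingHom))) := fun n => by
    rw [← ha n (hnU n)]; exact ptOfZ_mem_kernel _
  have hU' : ∀ n : ℕ, (.some (XU' n) (YU' n) (hnU' n) : (curveOver (E ⊔ ltField π n : IntermediateField F (AlgebraicClosure F))
      ((W.map (Int.castRingHom ℤ_[p])).map ((LTCoeff.of F).toRingHom.comp e.symm.toRingHom))).toAffine.Point) ∈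
      kernel (NormedField.valuation (K := (E ⊔ ltField π n : IntermediateField F (AlgebraicClosure F))))
        (curveOver (E ⊔ ltField π n : IntermediateField F (AlgebraicClosure F))
          ((W.map (Int.castRingHom ℤ_[p])).map ((LTCoeff.of F).toRingHom.comp e.symm.toRingHom))) := fun n => by
    rw [← ha' n (hnU' n)]; exact ptOfZ_mem_kernel _
  -- `T_R` read one level up
  have hread : ∀ (n : ℕ) (r : R), ((((inclUnitBall (F := F) (le_sup_left : E ≤ E ⊔ ltField π n) (ψ r) :
      unitBall (E ⊔ ltField π n : IntermediateField F (AlgebraicClosure F))) :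
      (E ⊔ ltField π n : IntermediateField F (AlgebraicClosure F))) : AlgebraicClosure F)) = ιv (j r) := fun n r => by
    rw [coe_inclUnitBall, IntermediateField.coe_inclusion]; exact hψj r
  have hTP' : ∀ n : ℕ, T.map ((inclUnitBall (F := F) (le_sup_left : E ≤ E ⊔ ltField π n)).toRingHom.comp ψ) =
      (hom (isLTRing_LTCoeff hπ) (isLTSeries_map_LTCoeff_of_degree_one e hq he hP)
        (isLTSeries_map_LTCoeff_of_degree_one e hq he hP) (LTCoeff.of F (c : 𝒪[F]))).map
        (algebraMap (LTCoeff F) (unitBall (E ⊔ ltField π n : IntermediateField F (AlgebraicClosure F)))) := fun n => by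
    rw [PowerSeries.map_comp, RingHom.comp_apply, hTP, ← RingHom.comp_apply (PowerSeries.map _)
      (PowerSeries.map (algebraMap (LTCoeff F) (unitBall E))), ← PowerSeries.map_comp, AlgHom.toRingHom_eq_coe,
      inclUnitBall_comp_algebraMap]
  -- `[c] z(U′_n) ≠ 0` (`c` a unit, `U′_n ≠ O`)
  have hs0 : ∀ n : ℕ, (((ltSMul (maxNilIdeal F (E ⊔ ltField π n : IntermediateField F (AlgebraicClosure F))) (isLTRing_LTCoeff hπ)
      (isLTSeries_map_LTCoeff_of_degree_one e hq he hP) (LTCoeff.of F (c : 𝒪[F])) (zPt _ (hU' n)) :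
      (maxNilIdeal F (E ⊔ ltField π n : IntermediateField F (AlgebraicClosure F))).toIdeal) :
      unitBall (E ⊔ ltField π n : IntermediateField F (AlgebraicClosure F))) :
      (E ⊔ ltField π n : IntermediateField F (AlgebraicClosure F))) ≠ 0 := by
    intro n h0
    have hz : ltSMul (maxNilIdeal F (E ⊔ ltField π n : IntermediateField F (AlgebraicClosure F))) (isLTRing_LTCoeff hπ)
        (isLTSeries_map_LTCoeff_of_degree_one e hq he hP) (LTCoeff.of F (c : 𝒪[F])) (zPt _ (hU' n)) = 0 :=
      Subtype.ext (Subtype.ext h0)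
    have hcu : IsUnit (LTCoeff.of F (c : 𝒪[F])) := (Units.isUnit c).map _
    have hz2 : ltSMul (maxNilIdeal F (E ⊔ ltField π n : IntermediateField F (AlgebraicClosure F))) (isLTRing_LTCoeff hπ)
        (isLTSeries_map_LTCoeff_of_degree_one e hq he hP) (LTCoeff.of F (c : 𝒪[F]) * 1) (zPt _ (hU' n)) = 0 := by
      rwa [mul_one]
    have hz1 : zPt _ (hU' n) = 0 := by
      have h3 := (ltSMul_mul_eq_zero_iff_of_isUnit (maxNilIdeal F (E ⊔ ltField π n : IntermediateField F (AlgebraicClosure F)))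
        (isLTRing_LTCoeff hπ) (isLTSeries_map_LTCoeff_of_degree_one e hq he hP) hcu 1 (zPt _ (hU' n))).mp hz2
      rwa [one_ltSMul] at h3
    have hpt := eq_ptOfZ_zPt (hU' n)
    rw [hz1, ptOfZ_zero] at hpt
    exact absurd hpt (Affine.Point.some_ne_zero _)
  -- levelwise: `[c]_{P′} z(U′_n) = z(U_n)`
  have hc : ∀ n : ℕ, zPt _ (hU n) =
      ltSMul (maxNilIdeal F (E ⊔ ltField π n : IntermediateField F (AlgebraicClosure F))) (isLTRing_LTCoeff hπ)
        (isLTSeries_map_LTCoeff_of_degree_one e hq he hP) (LTCoeff.of F (c : 𝒪[F])) (zPt _ (hU' n)) := fun n =>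
    (ltSMul_zPt_eq_zPt_of_readings_of_hom e hq hπ he hP W (E ⊔ ltField π n : IntermediateField F (AlgebraicClosure F)) ιc ιv
      ((inclUnitBall (F := F) (le_sup_left : E ≤ E ⊔ ltField π n)).toRingHom.comp ψ) j (fun r => hread n r) L h₂ h₃ hT hs hQr hPr
      (LTCoeff.of F (c : 𝒪[F])) hT0 (hTP' n) hidX hidY hΩ₁ hαΩ₁ (hu n) (hu' n) (hw n)
      (hαw n) (hαu n) (hQC _ (hw n) (hαw n)) hx₀ hy₀ hx₁ hy₁ (hxu n) (hyu n)
      (hxu' n) (hyu' n) (hxw n) (hyw n) (hxz n) (hyz n) (hXU n) (hYU n) (hXU' n) (hYU' n) (hXW n) (hYW n) (hXZ n) (hYZ n) (hU n)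
      (hU' n) (hs0 n) (htwo _)).symm
  exact unit_eq_mul_of_zPt_eq_ltSMul e hq hπ he hP (W.map (Int.castRingHom ℤ_[p])) E
    (fun n => (.some (XU' n) (YU' n) (hnU' n) : _)) (fun n => (.some (XU n) (YU n) (hnU n) : _)) hU' hU
    (fun n => ha' n (hnU' n)) (fun n => ha n (hnU n)) c hc

end TateUnitCM

end Literature.NumberTheory.EllipticCurves

end
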